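import Summits.Parity.GeneralizedHardyLittlewood.Theorems.BeyondDiagonalBeatsQuarter.CornerWeight
import HarnessLib

/-!
# Route `PrimeLevelFamEdge`, crux K_A `MomentsBeyondDiagonal` (stmt-Parity-20007), line «petersson_layers» v4, stub `stub_diag`:
# **pointwise structure of the one-dimensional Bose kernel `(e^{u+y/u} − 1)⁻¹` (census R2, first brick)**

The Bose coefficients `c_{a0}(y) = ∫₀^∞ (log u)^a (e^{u+y/u} − 1)⁻¹ du` (`…DiagBoseB0`) control the main terms of the
log-decorated diagonal. Their small-`y` behaviour (census R2; by the power counting of the g6 roadmap only the LEADING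
term `κ_{a0}·log^{a+1}(1/y)` should reach the main term) follows from three pointwise facts about the kernel, recorded here
with K_B's `Corner.rFun` (`r(x) = (eˣ−1)⁻¹ − x⁻¹`, `|r| ≤ ½`, `CornerWeight`):

* `bose0_kernel_eq` — `(e^{u+y/u} − 1)⁻¹ = u/(u² + y) + r(u + y/u)` (`u > 0`, `y ≥ 0`);
* `abs_bose0_kernel_sub_le` — **`|(e^{u+y/u} − 1)⁻¹ − u/(u²+y)| ≤ ½`**: on `(0,1]` the kernel is the rational weight
  `u/(u²+y)` up to a bounded error (integrable against every `|log u|^a`);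
* `rational_weight_eq` / `rational_weight_tail_le` — `u/(u²+y) = 1/u − y/(u(u²+y))` with `0 ≤ y/(u(u²+y)) ≤ y/u³`: above
  `u = √y` the weight is `1/u` up to a tail whose `|log u|^a`-moment over `[√y, 1]` is `O(log^a(1/y))`, giving
  `∫_{√y}^1 (log u)^a du/u = −log^{a+1}(√y)/(a+1)` as the leading term;
* `bose0_kernel_le_two_exp_neg` — `(e^{u+y/u} − 1)⁻¹ ≤ 2e^{−u}` for `u ≥ 1` (the range `u ≥ 1` is `O_a(1)`).

Def-free; theorems only. Helper `--supports stmt-Parity-20007`; closes nothing; K_A, K_B and the Parity summit are NOT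
proved; nothing about Landau–Siegel zeros.

## References
* E. Kowalski, P. Michel, J. VanderKam, J. reine angew. Math. 526 (2000), (21)–(28) pp. 12–15.
  [cite: KowalskiMichelVanderKam2000, (22)–(28) — derivation (the diagonal cut-off weight and its residues)]
-/

noncomputable section

namespace Summit.Parity.GeneralizedHardyLittlewood.Theorems.MomentsBeyondDiagonal.DiagLines

open Summit.Parity.GeneralizedHardyLittlewood.Theorems.BeyondDiagonalBeatsQuarter.Corner (rFun abs_rFun_le phi_pos
  scriptW_integrand_le_exp inv_exp_sub_one_le)

/-- **`(e^{u+y/u} − 1)⁻¹ = u/(u²+y) + r(u + y/u)`** for `u > 0`, `y ≥ 0` (`1/(u + y/u) = u/(u²+y)`). [folklore] -/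
theorem bose0_kernel_eq {u y : ℝ} (hu : 0 < u) (hy : 0 ≤ y) :
    (Real.exp (u + y / u) - 1)⁻¹ = u / (u ^ 2 + y) + rFun (u + y / u) := by
  unfold rFun
  have hφ : u + y / u = (u ^ 2 + y) / u := by field_simp
  have h2 : (u + y / u)⁻¹ = u / (u ^ 2 + y) := by
    rw [hφ, inv_div]
  rw [h2]
  ring

/-- **`|(e^{u+y/u} − 1)⁻¹ − u/(u²+y)| ≤ ½`** for `u > 0`, `y ≥ 0`. [folklore] -/
theorem abs_bose0_kernel_sub_le {u y : ℝ} (hu : 0 < u) (hy : 0 ≤ y) :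
    |(Real.exp (u + y / u) - 1)⁻¹ - u / (u ^ 2 + y)| ≤ 1 / 2 := by
  rw [bose0_kernel_eq hu hy, add_sub_cancel_left]
  exact abs_rFun_le (phi_pos hy hu)

/-- `u/(u²+y) = 1/u − y/(u(u²+y))` for `u > 0`, `y ≥ 0`. [folklore] -/
theorem rational_weight_eq {u y : ℝ} (hu : 0 < u) (hy : 0 ≤ y) :
    u / (u ^ 2 + y) = 1 / u - y / (u * (u ^ 2 + y)) := by
  have h1 : u ^ 2 + y ≠ 0 := by positivity
  field_simp
  ring

/-- `0 ≤ y/(u(u²+y)) ≤ y/u³` for `u > 0`, `y ≥ 0`. [folklore] -/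
theorem rational_weight_tail_le {u y : ℝ} (hu : 0 < u) (hy : 0 ≤ y) :
    0 ≤ y / (u * (u ^ 2 + y)) ∧ y / (u * (u ^ 2 + y)) ≤ y / u ^ 3 := by
  refine ⟨by positivity, ?_⟩
  apply div_le_div_of_nonneg_left hy (by positivity)
  nlinarith [mul_nonneg hu.le hy]

/-- `0 ≤ u/(u²+y) ≤ 1/u` for `u > 0`, `y ≥ 0`. [folklore] -/
theorem rational_weight_le_inv {u y : ℝ} (hu : 0 < u) (hy : 0 ≤ y) :
    0 ≤ u / (u ^ 2 + y) ∧ u / (u ^ 2 + y) ≤ 1 / u := by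
  refine ⟨by positivity, ?_⟩
  rw [div_le_div_iff₀ (by positivity) hu]
  nlinarith

/-- `0 ≤ u/(u²+y) ≤ u/y` for `u > 0`, `y > 0` (the range `u ≤ √y`). [folklore] -/
theorem rational_weight_le_div {u y : ℝ} (hu : 0 < u) (hy : 0 < y) :
    u / (u ^ 2 + y) ≤ u / y :=
  div_le_div_of_nonneg_left hu.le hy (by nlinarith)

/-- **`(e^{u+y/u} − 1)⁻¹ ≤ 2e^{−u}`** for `u ≥ 1`, `y ≥ 0`. [folklore] -/
theorem bose0_kernel_le_two_exp_neg {u y : ℝ} (hu : 1 ≤ u) (hy : 0 ≤ y) :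
    (Real.exp (u + y / u) - 1)⁻¹ ≤ 2 * Real.exp (-u) :=
  (scriptW_integrand_le_exp hy (by linarith)).trans (inv_exp_sub_one_le hu)

/-- The kernel is non-negative and at most `1/u` (`u > 0`, `y ≥ 0`). [folklore] -/
theorem bose0_kernel_nonneg_le {u y : ℝ} (hu : 0 < u) (hy : 0 ≤ y) :
    0 ≤ (Real.exp (u + y / u) - 1)⁻¹ ∧ (Real.exp (u + y / u) - 1)⁻¹ ≤ 1 / u := by
  have hφ := phi_pos hy hu
  have hpos : 0 < Real.exp (u + y / u) - 1 := sub_pos.2 (Real.one_lt_exp_iff.2 hφ)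
  refine ⟨(inv_pos.2 hpos).le, ?_⟩
  rw [inv_eq_one_div, div_le_div_iff₀ hpos hu]
  have h1 : u + y / u + 1 ≤ Real.exp (u + y / u) := Real.add_one_le_exp _
  have h2 : 0 ≤ y / u := div_nonneg hy hu.le
  linarith

end Summit.Parity.GeneralizedHardyLittlewood.Theorems.MomentsBeyondDiagonal.DiagLines

end
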